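import Summits.Ventures.LatticeQCDFlow.Scaling.DominatedStarRegimeFreeRelaxation
import Summits.Ventures.LatticeQCDFlow.Scaling.ExchangeSchemeCollector
import Literature.Probability.MarkovChains.FiniteDoeblinCondition
import Literature.Probability.MarkovChains.TimeAverageConcentration

/-!
HONEST FRAMING: exact (Metropolis-corrected) sampling algorithms for lattice gauge theory; figures
of merit are autocorrelation/cost numbers at stated couplings and volumes; no continuum-physics
claim.

# TwoLevelRegimeFreeDoeblin — ONE COLD LEVEL (`K = 1`), EXACT HOT REDRAWS, PER-ENTRY MAPS WITH ONE-SIDED DOMINATION `p·μ_1(φ_r u) ≤ μ_0(u)`: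
# `P³(x,·) ≥ t·((1−t)w_0)²·p · π̃(·)` FOR EVERY START, HENCE `d(n) ≤ (1 − t((1−t)w_0)²p)^{⌊n/3⌋}` AND
# `t_mix(ε) ≤ 3⌈log(1/ε)/(t((1−t)w_0)²p)⌉` — NO REGIME, NO VOLUME, NO `π̃_min` (lean-2 GEN-28, ours)

Venture-side (OURS).  Cell `lqcd-flow` (pub-lqcd), unit `pub-lqcd-lean-2-g28`, 2026-08-28.  Chapter N, file 18: OPEN-MATH-chapterM item 1
(a worst-start total-variation law free of the volume AND of the regime `4t ≤ p(1−t)w_0`) SETTLED FOR ONE COLD LEVEL.  Scheme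
`P = t·GSw + (1−t)·Π_w` on `S^{Fin 2}` with `m ≥ 1` entries, all on the edge `(0,1)`, entry `r` proposing through its own
bijection `φ_r` of `S`; exact hot redraws `M_0(u,·) = μ_0`; a `μ_1`-reversible cold kernel `M_1` (reversibility is used only for the
stationarity of `π̃ = μ_0 ⊗ μ_1`, as everywhere in the chapter); `0 ≤ t ≤ 1`, `w ≥ 0`, `Σw = 1`.  The three-step pattern REDRAW–SWAP–REDRAW minorises: after a hot redraw the hub holds `ξ ~ μ_0`; the swap through entry
`r` then hands the cold level the content `φ_r ξ`, accepted with the Metropolis ratio, and for the target content `v` the choice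
`ξ = φ_r⁻¹ v` contributes `μ_0(φ_r⁻¹v)·min{1, μ_0(φ_r⁻¹u_1)μ_1(v)/(μ_0(φ_r⁻¹v)μ_1(u_1))} = min{μ_0(φ_r⁻¹v), μ_0(φ_r⁻¹u_1)μ_1(v)/μ_1(u_1)}
≥ p·μ_1(v)` BY DOMINATION AT BOTH `v` AND THE CURRENT COLD CONTENT `u_1` — uniformly in `u_1`; the final redraw makes the hub
exact again.  So `P³(x,y) ≥ (1−t)w_0 · t · (1−t)w_0 · p · μ_0(y_0)μ_1(y_1)` and Doeblin's theorem (Saloff-Coste 1997 Thm 1.2.7, in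
the tree) gives the geometric law with NO dependence on `|S|`, `μ_min` or a regime.  A Doeblin hot sampler `M_0(u,·) ≥ a·μ_0` (chapter N's
`γ₀ = a` case) contributes its `a·μ_0` component at both redraws: the same with `(1−t)w_0·a` for `(1−t)w_0`.

## What is proved

* **`detEntryKernel_mul_apply_swap`** (any `K`) — the Metropolis kernel of the deterministic proposal `a ↦ a^{(ψ,i,l)}` satisfies
  `π̃(a)·Met(a, a^{(ψ,i,l)}) = min{π̃(a), π̃(a^{(ψ,i,l)})}`.
* **`exchangeScheme_apply_update_zero_ge_of_minorized`** / **`exchangeScheme_apply_update_zero_ge`** (any `K`, `0 ≤ t ≤ 1`) —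
  `P(x, x^{0←v}) ≥ (1−t)w_0·a·μ_0(v)` under `M_0(u,·) ≥ a·μ_0` (`a = 1`: exact hot redraws);
  **`exchangeScheme_apply_ge_swap`** — `P ≥ t·GSw` entrywise.
* **`twoLevel_pow_three_ge_of_minorized`** / **`twoLevel_pow_three_ge`** — `K = 1`: `P³(x,y) ≥ t((1−t)w_0·a)²p·π̃(y)` for all `x, y` under a hot
  MINORISATION `M_0(u,·) ≥ a·μ_0` (Doeblin hot samplers, e.g. an independence sampler of acceptance floor `a`), `a = 1` for exact redraws;
  **`twoLevel_doeblinCondition_of_minorized`**.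
* **`twoLevel_worstTvDist_le_of_minorized`** / **`twoLevel_worstTvDist_le`** — `d(n) ≤ (1 − t((1−t)w_0·a)²p)^{⌊n/3⌋}`;
  **`twoLevel_mixingTime_le_of_minorized`** / **`twoLevel_mixingTime_le`** — `t_mix(ε) ≤ 3·⌈log(1/ε)/(t((1−t)w_0·a)²p)⌉` (`0 < ε`).

Reading (no numerics implied): with one cold level the map-assisted exchange with exact hot redraws forgets ANY start at the
volume-free rate `t((1−t)w_0)²p/3` per step — at `t = ½`, `w_0 = 1`: `p/8` per three steps — with no condition tying `t` to `p`.
NOT CLAIMED: `K ≥ 2` (the same pattern needs `2K+1` consecutive steps and gives a rate exponentially small in `K`; the `K`-level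
worst-start law without the volume logarithm stays OPEN-MATH-chapterM item 1); anything measured.  Literature grade (cell rule): OWN
RESULT on the tree's Doeblin theorem [Saloffcoste1997, Thm 1.2.7] (`Literature/Probability/MarkovChains/FiniteDoeblinCondition`);
nothing new cited as a fact; no new bib keys.
-/

noncomputable section

open Finset Function Matrix
open Literature.Probability.MarkovChains

namespace Summit.Ventures.LatticeQCDFlow.Scaling

variable {S : Type*} [Fintype S] [DecidableEq S] {K m : ℕ} {μ : Fin (K + 1) → S → ℝ} {M : Fin (K + 1) → S → S → ℝ}
  {w : Fin (K + 1) → ℝ} {t p : ℝ}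

/-! ## §1 Two entrywise floors of the scheme (any `K`) -/

/-- **The deterministic-proposal Metropolis kernel at its proposal:** `π̃(a)·Met(a, a^{(ψ,i,l)}) = min{π̃(a), π̃(a^{(ψ,i,l)})}`
(`i ≠ l`, positive laws). [ours] -/
theorem detEntryKernel_mul_apply_swap (hμ : ∀ k x, 0 < μ k x) (ψ : Equiv.Perm S) {i l : Fin (K + 1)} (hil : i ≠ l)
    (a : Fin (K + 1) → S) :
    tensorFun μ a * mhKernel (fun a b : Fin (K + 1) → S => if b = edgeFlowSwap ψ i l a then (1 : ℝ) else 0) (tensorFun μ) a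
        (edgeFlowSwap ψ i l a) = min (tensorFun μ a) (tensorFun μ (edgeFlowSwap ψ i l a)) := by
  have hπ := tensorFun_pos hμ
  by_cases hfix : edgeFlowSwap ψ i l a = a
  · rw [hfix, min_self, mhKernel_self]
    have h0 : ∑ z ∈ univ.erase a, mhRate (fun a b : Fin (K + 1) → S => if b = edgeFlowSwap ψ i l a then (1 : ℝ) else 0)
        (tensorFun μ) a z = 0 := by
      refine sum_eq_zero fun z hz => ?_
      have hza : z ≠ a := ne_of_mem_erase hz
      unfold mhRate
      dsimp only
      have h1 : (if z = edgeFlowSwap ψ i l a then (1 : ℝ) else 0) = 0 := if_neg (by rwa [hfix])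
      have h2 : (if a = edgeFlowSwap ψ i l z then (1 : ℝ) else 0) = 0 := by
        refine if_neg fun h => hza ?_
        have := congrArg (edgeFlowSwap ψ i l) h
        rw [edgeFlowSwap_edgeFlowSwap ψ hil] at this
        rw [← this, hfix]
      rw [h1, h2, mul_zero, zero_div, min_self]
    rw [h0, sub_zero, mul_one]
  · rw [mhKernel_of_ne hfix, mul_mhRate hπ]
    simp only [edgeFlowSwap_edgeFlowSwap ψ hil, if_true, mul_one]

section Scheme
variable (e : Fin m → Fin (K + 1) × Fin (K + 1)) (φ : Fin m → Equiv.Perm S)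

/-- **`P(x, x^{0←v}) ≥ (1−t)w_0·a·μ_0(v)`** under a hot MINORISATION `M_0(u,·) ≥ a·μ_0` (`0 ≤ t ≤ 1`, `w ≥ 0`, non-negative kernels). [ours] -/
theorem exchangeScheme_apply_update_zero_ge_of_minorized (hμ : ∀ k x, 0 < μ k x) (hM : ∀ k, IsRowStochastic (M k))
    {a : ℝ} (hmin : ∀ u v, a * μ 0 v ≤ M 0 u v) (hw0 : ∀ k, 0 ≤ w k) (ht0 : 0 ≤ t) (ht1 : t ≤ 1) (x : Fin (K + 1) → S)
    (v : S) :
    (1 - t) * w 0 * a * μ 0 v ≤ t * ptGraphSwap μ e φ x (update x 0 v) + (1 - t) * prodKernel w M x (update x 0 v) := by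
  have hsw : 0 ≤ t * ptGraphSwap μ e φ x (update x 0 v) := mul_nonneg ht0 ((ptGraphSwap_isRowStochastic hμ).1 _ _)
  have hprod : w 0 * (a * μ 0 v) ≤ prodKernel w M x (update x 0 v) := by
    rw [prodKernel_apply]
    have hterm : w 0 * coordKernel M 0 x (update x 0 v) = w 0 * M 0 (x 0) v := by
      unfold coordKernel
      rw [update_self, if_pos rfl]
    refine le_trans (mul_le_mul_of_nonneg_left (hmin (x 0) v) (hw0 0)) ?_
    rw [← hterm]
    exact single_le_sum (f := fun j => w j * coordKernel M j x (update x 0 v))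
      (fun j _ => mul_nonneg (hw0 j) (coordKernel_nonneg M (fun k u v => (hM k).1 u v) j _ _)) (mem_univ 0)
  have h1t : 0 ≤ 1 - t := by linarith
  nlinarith [mul_le_mul_of_nonneg_left hprod h1t]

/-- **`P(x, x^{0←v}) ≥ (1−t)w_0·μ_0(v)`** under exact hot redraws (`0 ≤ t ≤ 1`, `w ≥ 0`, non-negative kernels). [ours] -/
theorem exchangeScheme_apply_update_zero_ge (hμ : ∀ k x, 0 < μ k x) (hM : ∀ k, IsRowStochastic (M k))
    (hM0 : ∀ u v, M 0 u v = μ 0 v) (hw0 : ∀ k, 0 ≤ w k) (ht0 : 0 ≤ t) (ht1 : t ≤ 1) (x : Fin (K + 1) → S) (v : S) :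
    (1 - t) * w 0 * μ 0 v ≤ t * ptGraphSwap μ e φ x (update x 0 v) + (1 - t) * prodKernel w M x (update x 0 v) := by
  have h := exchangeScheme_apply_update_zero_ge_of_minorized e φ hμ hM (a := 1) (fun u v => by rw [hM0, one_mul]) hw0 ht0 ht1 x v
  rwa [mul_one] at h

/-- **`P ≥ t·GSw` entrywise** (`t ≤ 1`, `w ≥ 0`, non-negative kernels). [ours] -/
theorem exchangeScheme_apply_ge_swap (hM : ∀ k, IsRowStochastic (M k)) (hw0 : ∀ k, 0 ≤ w k) (ht1 : t ≤ 1)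
    (x y : Fin (K + 1) → S) :
    t * ptGraphSwap μ e φ x y ≤ t * ptGraphSwap μ e φ x y + (1 - t) * prodKernel w M x y := by
  have h : 0 ≤ prodKernel w M x y := by
    rw [prodKernel_apply]
    exact sum_nonneg fun j _ => mul_nonneg (hw0 j) (coordKernel_nonneg M (fun k u v => (hM k).1 u v) j _ _)
  nlinarith

end Scheme

/-! ## §2 One cold level: the three-step minorisation and Doeblin's law -/

section TwoLevel
variable {μ : Fin (1 + 1) → S → ℝ} {M : Fin (1 + 1) → S → S → ℝ} {w : Fin (1 + 1) → ℝ}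
variable (κ : Fin m → Fin 1) (φ : Fin m → Equiv.Perm S)

omit [Fintype S] [DecidableEq S] in
/-- `π̃(x) = μ_0(x_0)·μ_1(x_1)` for two levels. -/
theorem tensorFun_two (μ : Fin (1 + 1) → S → ℝ) (x : Fin (1 + 1) → S) : tensorFun μ x = μ 0 (x 0) * μ 1 (x 1) := by
  unfold tensorFun
  rw [Fin.prod_univ_two]

omit [Fintype S] [DecidableEq S] in
/-- The swap of `(ξ, u)` along `(0,1)` through `ψ` is `(ψ⁻¹u, ψξ)`: with `ξ = ψ⁻¹v`, `x^{0←ψ⁻¹v} ↦ y^{0←ψ⁻¹(x_1)}` for every `y` with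
`y_1 = v`. -/
theorem edgeFlowSwap_update_two (ψ : Equiv.Perm S) (x y : Fin (1 + 1) → S) :
    edgeFlowSwap ψ 0 1 (update x 0 (ψ.symm (y 1))) = update y 0 (ψ.symm (x 1)) := by
  funext i
  have h01 : (0 : Fin (1 + 1)) ≠ 1 := by decide
  rcases Fin.eq_zero_or_eq_succ i with hi | ⟨j, hj⟩
  · rw [hi, edgeFlowSwap_fst ψ h01, update_self, update_of_ne h01.symm]
  · have hj1 : j = 0 := Fin.eq_zero j
    subst hj1
    have hi1 : i = 1 := hj
    rw [hi1, update_of_ne h01.symm]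
    exact (edgeFlowSwap_snd ψ 0 1 _).trans (by rw [update_self, Equiv.apply_symm_apply])

/-- **THE THREE-STEP MINORISATION UNDER A HOT MINORISATION `M_0(u,·) ≥ a·μ_0`: `P³(x,y) ≥ t((1−t)w_0·a)²p·π̃(y)`** for one cold level,
per-entry maps with `p·μ_1(φ_r u) ≤ μ_0(u)` (any real `p`), `0 ≤ a`, `0 ≤ t ≤ 1`, `w ≥ 0`, `m ≥ 1` (the scheme as a `Matrix`, so that `^` is the
matrix power; the hot step contributes only its `a·μ_0` component). [ours] -/
theorem twoLevel_pow_three_ge_of_minorized (hm : 1 ≤ m) (hμ : ∀ k x, 0 < μ k x) (hM : ∀ k, IsRowStochastic (M k))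
    {a : ℝ} (ha : 0 ≤ a) (hmin : ∀ u v, a * μ 0 v ≤ M 0 u v) (hw0 : ∀ k, 0 ≤ w k) (ht0 : 0 ≤ t) (ht1 : t ≤ 1)
    (hdom : ∀ r u, p * μ (κ r).succ (φ r u) ≤ μ 0 u) (x y : Fin (1 + 1) → S) :
    t * ((1 - t) * w 0 * a) ^ 2 * p * tensorFun μ y
      ≤ ((Matrix.of fun a b : Fin (1 + 1) → S =>
          t * ptGraphSwap μ (fun r : Fin m => (((0 : Fin (1 + 1)), (κ r).succ) : Fin (1 + 1) × Fin (1 + 1))) φ a b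
            + (1 - t) * prodKernel w M a b) ^ 3) x y := by
  have hmpos : (0 : ℝ) < m := Nat.cast_pos.mpr (by omega)
  have hπ := tensorFun_pos hμ
  have h1t : 0 ≤ 1 - t := by linarith
  -- every entry is the edge `(0,1)`
  have hE : (fun r : Fin m => (((0 : Fin (1 + 1)), (κ r).succ) : Fin (1 + 1) × Fin (1 + 1)))
      = fun _ => (((0 : Fin (1 + 1)), (1 : Fin (1 + 1))) : Fin (1 + 1) × Fin (1 + 1)) := by
    funext r; rw [Fin.eq_zero (κ r)]; rfl
  have hdom1 : ∀ (r : Fin m) (u : S), p * μ 1 (φ r u) ≤ μ 0 u := fun r u => by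
    have h := hdom r u; rwa [Fin.eq_zero (κ r)] at h
  rw [hE]
  set e : Fin m → Fin (1 + 1) × Fin (1 + 1) := fun _ => (((0 : Fin (1 + 1)), (1 : Fin (1 + 1))) : Fin (1 + 1) × Fin (1 + 1))
    with he_def
  have he : ∀ r, (e r).1 ≠ (e r).2 := fun r => by simp only [he_def]; decide
  set P : (Fin (1 + 1) → S) → (Fin (1 + 1) → S) → ℝ := fun a b =>
    t * ptGraphSwap μ e φ a b + (1 - t) * prodKernel w M a b with hPdef
  -- entrywise floors
  have hprod0 : ∀ a b, 0 ≤ prodKernel w M a b := fun a b => by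
    rw [prodKernel_apply]
    exact sum_nonneg fun j _ => mul_nonneg (hw0 j) (coordKernel_nonneg M (fun k u v => (hM k).1 u v) j _ _)
  have hP0 : ∀ a b, 0 ≤ P a b := fun a b =>
    add_nonneg (mul_nonneg ht0 ((ptGraphSwap_isRowStochastic hμ).1 _ _)) (mul_nonneg h1t (hprod0 a b))
  have hPsw : ∀ a b, t * ptGraphSwap μ e φ a b ≤ P a b := fun a b =>
    exchangeScheme_apply_ge_swap e φ hM hw0 ht1 a b
  have hPup : ∀ (b : Fin (1 + 1) → S) (v : S), (1 - t) * w 0 * a * μ 0 v ≤ P b (update b 0 v) := fun b v =>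
    exchangeScheme_apply_update_zero_ge_of_minorized e φ hμ hM hmin hw0 ht0 ht1 b v
  -- the entry kernels
  set Met : Fin m → (Fin (1 + 1) → S) → (Fin (1 + 1) → S) → ℝ := fun r =>
    mhKernel (fun a b : Fin (1 + 1) → S => if b = edgeFlowSwap (φ r) (e r).1 (e r).2 a then (1 : ℝ) else 0) (tensorFun μ)
    with hMet
  have hMet0 : ∀ r a b, 0 ≤ Met r a b := fun r a b =>
    mhKernel_nonneg (entryProposal_basic (φ := φ) he r).1 (entryProposal_basic (φ := φ) he r).2.1 hπ a b
  have hGSw : ∀ a b, ptGraphSwap μ e φ a b = ∑ r, (1 : ℝ) / m * Met r a b := fun a b =>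
    ptGraphSwap_eq_avg_entryKernel hm he hμ a b
  -- the cube, expanded
  have hcube : ((Matrix.of P) ^ 3) x y = ∑ b, ∑ a', P x a' * P a' b * P b y := by
    rw [pow_three', Matrix.mul_apply]
    refine sum_congr rfl fun b _ => ?_
    rw [Matrix.mul_apply, sum_mul]
    rfl
  -- the path `x → x^{0←φ_r⁻¹ y_1} → y^{0←φ_r⁻¹ x_1} → y` for each entry `r`
  have hpath : ∀ r : Fin m, ((1 - t) * w 0 * a) ^ 2 * p * tensorFun μ y ≤ ∑ b, ∑ a', P x a' * Met r a' b * P b y := by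
    intro r
    set ξ : S := (φ r).symm (y 1) with hξ
    set η : S := (φ r).symm (x 1) with hη
    set a₀ : Fin (1 + 1) → S := update x 0 ξ with ha₀
    set b₀ : Fin (1 + 1) → S := update y 0 η with hb₀
    have hswap : edgeFlowSwap (φ r) (e r).1 (e r).2 a₀ = b₀ := edgeFlowSwap_update_two (φ r) x y
    -- the three factors
    have h1 : (1 - t) * w 0 * a * μ 0 ξ ≤ P x a₀ := hPup x ξ
    have h3 : (1 - t) * w 0 * a * μ 0 (y 0) ≤ P b₀ y := by
      have hy : update b₀ 0 (y 0) = y := by rw [hb₀, update_idem, update_eq_self]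
      have h := hPup b₀ (y 0); rwa [hy] at h
    have h2 : p * μ 1 (y 1) ≤ μ 0 ξ * Met r a₀ b₀ := by
      have hkey : tensorFun μ a₀ * Met r a₀ b₀ = min (tensorFun μ a₀) (tensorFun μ b₀) := by
        rw [← hswap]; exact detEntryKernel_mul_apply_swap hμ (φ r) (he r) a₀
      have ha : tensorFun μ a₀ = μ 0 ξ * μ 1 (x 1) := by
        rw [tensorFun_two, ha₀, update_self, update_of_ne (by decide : (1 : Fin (1 + 1)) ≠ 0)]
      have hb : tensorFun μ b₀ = μ 0 η * μ 1 (y 1) := by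
        rw [tensorFun_two, hb₀, update_self, update_of_ne (by decide : (1 : Fin (1 + 1)) ≠ 0)]
      have hξp : p * μ 1 (y 1) ≤ μ 0 ξ := by
        have h := hdom1 r ξ; rwa [hξ, Equiv.apply_symm_apply] at h
      have hηp : p * μ 1 (x 1) ≤ μ 0 η := by
        have h := hdom1 r η; rwa [hη, Equiv.apply_symm_apply] at h
      have hmin : p * μ 1 (y 1) * μ 1 (x 1) ≤ min (tensorFun μ a₀) (tensorFun μ b₀) := by
        rw [ha, hb]
        refine le_min ?_ ?_
        · exact mul_le_mul_of_nonneg_right hξp (hμ 1 _).le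
        · nlinarith [hμ 1 (y 1), mul_le_mul_of_nonneg_right hηp (hμ 1 (y 1)).le]
      have hx1 : 0 < μ 1 (x 1) := hμ 1 _
      have hprodeq : μ 1 (x 1) * (μ 0 ξ * Met r a₀ b₀) = min (tensorFun μ a₀) (tensorFun μ b₀) := by
        rw [← hkey, ha]; ring
      refine le_of_mul_le_mul_left ?_ hx1
      rw [hprodeq]
      linarith
    -- the single term `(a₀, b₀)` of the non-negative double sum
    have hterm : ((1 - t) * w 0 * a) ^ 2 * p * tensorFun μ y ≤ P x a₀ * Met r a₀ b₀ * P b₀ y := by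
      have hw : 0 ≤ (1 - t) * w 0 * a := mul_nonneg (mul_nonneg h1t (hw0 0)) ha
      have hA : 0 ≤ (1 - t) * w 0 * a * μ 0 ξ := mul_nonneg hw (hμ 0 ξ).le
      have hC : 0 ≤ (1 - t) * w 0 * a * μ 0 (y 0) := mul_nonneg hw (hμ 0 _).le
      calc ((1 - t) * w 0 * a) ^ 2 * p * tensorFun μ y
          = ((1 - t) * w 0 * a) * (p * μ 1 (y 1)) * ((1 - t) * w 0 * a * μ 0 (y 0)) := by rw [tensorFun_two]; ring
        _ ≤ ((1 - t) * w 0 * a) * (μ 0 ξ * Met r a₀ b₀) * ((1 - t) * w 0 * a * μ 0 (y 0)) :=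
          mul_le_mul_of_nonneg_right (mul_le_mul_of_nonneg_left h2 hw) hC
        _ = ((1 - t) * w 0 * a * μ 0 ξ) * Met r a₀ b₀ * ((1 - t) * w 0 * a * μ 0 (y 0)) := by ring
        _ ≤ P x a₀ * Met r a₀ b₀ * P b₀ y := by
          have hB : 0 ≤ Met r a₀ b₀ := hMet0 r a₀ b₀
          calc ((1 - t) * w 0 * a * μ 0 ξ) * Met r a₀ b₀ * ((1 - t) * w 0 * a * μ 0 (y 0))
              ≤ P x a₀ * Met r a₀ b₀ * ((1 - t) * w 0 * a * μ 0 (y 0)) :=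
                mul_le_mul_of_nonneg_right (mul_le_mul_of_nonneg_right h1 hB) hC
            _ ≤ P x a₀ * Met r a₀ b₀ * P b₀ y :=
                mul_le_mul_of_nonneg_left h3 (mul_nonneg (hP0 x a₀) hB)
    refine hterm.trans ?_
    have hin : P x a₀ * Met r a₀ b₀ * P b₀ y ≤ ∑ a', P x a' * Met r a' b₀ * P b₀ y :=
      single_le_sum (f := fun a' => P x a' * Met r a' b₀ * P b₀ y)
        (fun a' _ => mul_nonneg (mul_nonneg (hP0 x a') (hMet0 r a' b₀)) (hP0 b₀ y)) (mem_univ a₀)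
    exact hin.trans (single_le_sum (f := fun b => ∑ a', P x a' * Met r a' b * P b y)
      (fun b _ => sum_nonneg fun a' _ => mul_nonneg (mul_nonneg (hP0 x a') (hMet0 r a' b)) (hP0 b y)) (mem_univ b₀))
  -- assemble: `P³(x,y) ≥ Σ_bΣ_a P(x,a)·tGSw(a,b)·P(b,y) = (t/m)Σ_r Σ_bΣ_a P(x,a)Met_r(a,b)P(b,y) ≥ (t/m)·m·h²p·π̃(y)`
  rw [hcube]
  calc t * ((1 - t) * w 0 * a) ^ 2 * p * tensorFun μ y
      = ∑ _r : Fin m, t / m * (((1 - t) * w 0 * a) ^ 2 * p * tensorFun μ y) := by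
        rw [sum_const, card_univ, Fintype.card_fin, nsmul_eq_mul]; field_simp
    _ ≤ ∑ r : Fin m, t / m * ∑ b, ∑ a', P x a' * Met r a' b * P b y :=
        sum_le_sum fun r _ => mul_le_mul_of_nonneg_left (hpath r) (by positivity)
    _ = ∑ b, ∑ a', P x a' * (t * ∑ r, (1 : ℝ) / m * Met r a' b) * P b y := by
        have hre : ∀ b a', P x a' * (t * ∑ r, (1 : ℝ) / m * Met r a' b) * P b y
            = ∑ r, t / m * (P x a' * Met r a' b * P b y) := fun b a' => by
          rw [mul_sum, mul_sum, sum_mul]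
          exact sum_congr rfl fun r _ => by ring
        calc ∑ r : Fin m, t / m * ∑ b, ∑ a', P x a' * Met r a' b * P b y
            = ∑ r : Fin m, ∑ b, ∑ a', t / m * (P x a' * Met r a' b * P b y) := by simp_rw [mul_sum]
          _ = ∑ b, ∑ r : Fin m, ∑ a', t / m * (P x a' * Met r a' b * P b y) := sum_comm
          _ = ∑ b, ∑ a', ∑ r : Fin m, t / m * (P x a' * Met r a' b * P b y) := sum_congr rfl fun b _ => sum_comm
          _ = _ := sum_congr rfl fun b _ => sum_congr rfl fun a' _ => (hre b a').symm
    _ ≤ ∑ b, ∑ a', P x a' * P a' b * P b y := by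
        refine sum_le_sum fun b _ => sum_le_sum fun a' _ => ?_
        rw [← hGSw a' b]
        exact mul_le_mul_of_nonneg_right (mul_le_mul_of_nonneg_left (hPsw a' b) (hP0 x a')) (hP0 b y)

/-- **THE THREE-STEP MINORISATION: `P³(x,y) ≥ t((1−t)w_0)²p·π̃(y)`** for one cold level, EXACT hot redraws, per-entry maps with
`p·μ_1(φ_r u) ≤ μ_0(u)` (any real `p`), `0 ≤ t ≤ 1`, `w ≥ 0`, `m ≥ 1`. [ours] -/
theorem twoLevel_pow_three_ge (hm : 1 ≤ m) (hμ : ∀ k x, 0 < μ k x) (hM : ∀ k, IsRowStochastic (M k))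
    (hM0 : ∀ u v, M 0 u v = μ 0 v) (hw0 : ∀ k, 0 ≤ w k) (ht0 : 0 ≤ t) (ht1 : t ≤ 1)
    (hdom : ∀ r u, p * μ (κ r).succ (φ r u) ≤ μ 0 u) (x y : Fin (1 + 1) → S) :
    t * ((1 - t) * w 0) ^ 2 * p * tensorFun μ y
      ≤ ((Matrix.of fun a b : Fin (1 + 1) → S =>
          t * ptGraphSwap μ (fun r : Fin m => (((0 : Fin (1 + 1)), (κ r).succ) : Fin (1 + 1) × Fin (1 + 1))) φ a b
            + (1 - t) * prodKernel w M a b) ^ 3) x y := by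
  have h := twoLevel_pow_three_ge_of_minorized κ φ hm hμ hM zero_le_one (fun u v => by rw [hM0, one_mul]) hw0 ht0 ht1 hdom x y
  rwa [mul_one] at h

/-- **THE DOEBLIN CONDITION** `(D)` at `k = 3`, `c = t((1−t)w_0·a)²p`, `q = π̃`, under a hot minorisation `M_0(u,·) ≥ a·μ_0`. [ours] -/
theorem twoLevel_doeblinCondition_of_minorized (hm : 1 ≤ m) (hμ : ∀ k x, 0 < μ k x) (hμ1 : ∀ k, ∑ u, μ k u = 1)
    (hM : ∀ k, IsRowStochastic (M k)) {a : ℝ} (ha : 0 ≤ a) (hmin : ∀ u v, a * μ 0 v ≤ M 0 u v) (hw0 : ∀ k, 0 ≤ w k)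
    (ht0 : 0 ≤ t) (ht1 : t ≤ 1) (hdom : ∀ r u, p * μ (κ r).succ (φ r u) ≤ μ 0 u) :
    DoeblinCondition (Matrix.of fun a b : Fin (1 + 1) → S =>
        t * ptGraphSwap μ (fun r : Fin m => (((0 : Fin (1 + 1)), (κ r).succ) : Fin (1 + 1) × Fin (1 + 1))) φ a b
          + (1 - t) * prodKernel w M a b) 3 (t * ((1 - t) * w 0 * a) ^ 2 * p) (tensorFun μ) :=
  ⟨fun z => (tensorFun_pos hμ z).le, sum_tensorFun_eq_one μ hμ1,
    fun x y => twoLevel_pow_three_ge_of_minorized κ φ hm hμ hM ha hmin hw0 ht0 ht1 hdom x y⟩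

/-- **`d(n) ≤ (1 − t((1−t)w_0·a)²p)^{⌊n/3⌋}` under a hot minorisation `M_0(u,·) ≥ a·μ_0`** (one cold level, per-entry maps with one-sided
domination, `μ_k`-reversible kernels, `Σw = 1`) — NO REGIME, NO VOLUME. [ours] -/
theorem twoLevel_worstTvDist_le_of_minorized [Nonempty S] (hm : 1 ≤ m) (hμ : ∀ k x, 0 < μ k x) (hμ1 : ∀ k, ∑ u, μ k u = 1)
    (hM : ∀ k, IsRowStochastic (M k)) (hMrev : ∀ k, DetailedBalance (μ k) (M k)) {a : ℝ} (ha : 0 ≤ a)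
    (hmin : ∀ u v, a * μ 0 v ≤ M 0 u v) (hw0 : ∀ k, 0 ≤ w k) (hw1 : ∑ k, w k = 1) (ht0 : 0 ≤ t) (ht1 : t ≤ 1)
    (hdom : ∀ r u, p * μ (κ r).succ (φ r u) ≤ μ 0 u) (n : ℕ) :
    worstTvDist (fun a b : Fin (1 + 1) → S =>
        t * ptGraphSwap μ (fun r : Fin m => (((0 : Fin (1 + 1)), (κ r).succ) : Fin (1 + 1) × Fin (1 + 1))) φ a b
          + (1 - t) * prodKernel w M a b) (tensorFun μ) n ≤ (1 - t * ((1 - t) * w 0 * a) ^ 2 * p) ^ (n / 3) := by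
  set P : (Fin (1 + 1) → S) → (Fin (1 + 1) → S) → ℝ := fun a b =>
    t * ptGraphSwap μ (fun r : Fin m => (((0 : Fin (1 + 1)), (κ r).succ) : Fin (1 + 1) × Fin (1 + 1))) φ a b
      + (1 - t) * prodKernel w M a b with hPdef
  have hPst : IsRowStochastic P :=
    weightedScheme_isRowStochastic (ptGraphSwap_isRowStochastic hμ) hM hw0 hw1 ht0 ht1
  have hst : IsStationary (tensorFun μ) P :=
    (weightedScheme_detailedBalance (ptGraphSwap_detailedBalance hμ) hMrev t).isStationary hPst.2
  have hD := twoLevel_doeblinCondition_of_minorized κ φ hm hμ hμ1 hM ha hmin hw0 ht0 ht1 hdom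
  have hvec : tensorFun μ ᵥ* Matrix.of P = tensorFun μ := funext fun j => hst j
  refine ciSup_le fun x => ?_
  have hrow : lawAt P (Pi.single x 1) n = fun j => ((Matrix.of P) ^ n) x j :=
    funext fun j => kernelAt_eq_pow_apply (Matrix.of P) n x j
  rw [hrow]
  exact Saloffcoste1997_thm_1_2_7_tvDist (M := Matrix.of P) hPst hD (fun z => (tensorFun_pos hμ z).le)
    (sum_tensorFun_eq_one μ hμ1) hvec x n

/-- **`d(n) ≤ (1 − t((1−t)w_0)²p)^{⌊n/3⌋}`, NO REGIME, NO VOLUME** (one cold level, EXACT hot redraws, per-entry maps with one-sided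
domination with any real `p`, `μ_k`-reversible kernels, `Σw = 1`). [ours] -/
theorem twoLevel_worstTvDist_le [Nonempty S] (hm : 1 ≤ m) (hμ : ∀ k x, 0 < μ k x) (hμ1 : ∀ k, ∑ u, μ k u = 1)
    (hM : ∀ k, IsRowStochastic (M k)) (hMrev : ∀ k, DetailedBalance (μ k) (M k)) (hM0 : ∀ u v, M 0 u v = μ 0 v)
    (hw0 : ∀ k, 0 ≤ w k) (hw1 : ∑ k, w k = 1) (ht0 : 0 ≤ t) (ht1 : t ≤ 1)
    (hdom : ∀ r u, p * μ (κ r).succ (φ r u) ≤ μ 0 u) (n : ℕ) :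
    worstTvDist (fun a b : Fin (1 + 1) → S =>
        t * ptGraphSwap μ (fun r : Fin m => (((0 : Fin (1 + 1)), (κ r).succ) : Fin (1 + 1) × Fin (1 + 1))) φ a b
          + (1 - t) * prodKernel w M a b) (tensorFun μ) n ≤ (1 - t * ((1 - t) * w 0) ^ 2 * p) ^ (n / 3) := by
  have h := twoLevel_worstTvDist_le_of_minorized κ φ hm hμ hμ1 hM hMrev zero_le_one (fun u v => by rw [hM0, one_mul]) hw0 hw1
    ht0 ht1 hdom n
  rwa [mul_one] at h

/-- **`t_mix(ε) ≤ 3·⌈log(1/ε)/(t((1−t)w_0·a)²p)⌉` under a hot minorisation `M_0(u,·) ≥ a·μ_0`**, NO REGIME, NO VOLUME (`0 < a`, `0 < t < 1`,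
`w_0 > 0`, `0 < p`, `0 < ε`). [ours] -/
theorem twoLevel_mixingTime_le_of_minorized [Nonempty S] (hm : 1 ≤ m) (hμ : ∀ k x, 0 < μ k x) (hμ1 : ∀ k, ∑ u, μ k u = 1)
    (hM : ∀ k, IsRowStochastic (M k)) (hMrev : ∀ k, DetailedBalance (μ k) (M k)) {a : ℝ} (ha : 0 < a)
    (hmin : ∀ u v, a * μ 0 v ≤ M 0 u v) (hw0 : ∀ k, 0 ≤ w k) (hw1 : ∑ k, w k = 1) (hwhot : 0 < w 0) (ht0 : 0 < t)
    (ht1 : t < 1) (hp : 0 < p) (hdom : ∀ r u, p * μ (κ r).succ (φ r u) ≤ μ 0 u) {ε : ℝ} (hε : 0 < ε) :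
    mixingTime (fun a b : Fin (1 + 1) → S =>
        t * ptGraphSwap μ (fun r : Fin m => (((0 : Fin (1 + 1)), (κ r).succ) : Fin (1 + 1) × Fin (1 + 1))) φ a b
          + (1 - t) * prodKernel w M a b) (tensorFun μ) ε
      ≤ 3 * ⌈Real.log (1 / ε) / (t * ((1 - t) * w 0 * a) ^ 2 * p)⌉₊ := by
  have h1t : 0 < 1 - t := by linarith
  set δ : ℝ := t * ((1 - t) * w 0 * a) ^ 2 * p with hδ
  have hδ0 : 0 < δ := by positivity
  have hδ1 : δ ≤ 1 := (twoLevel_doeblinCondition_of_minorized κ φ hm hμ hμ1 hM ha.le hmin hw0 ht0.le ht1.le hdom).c_le_one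
    (weightedScheme_isRowStochastic (ptGraphSwap_isRowStochastic hμ) hM hw0 hw1 ht0.le ht1.le)
  set J : ℕ := ⌈Real.log (1 / ε) / δ⌉₊ with hJ
  refine mixingTime_le _ _ ((twoLevel_worstTvDist_le_of_minorized κ φ hm hμ hμ1 hM hMrev ha.le hmin hw0 hw1 ht0.le ht1.le
    hdom (3 * J)).trans ?_)
  rw [Nat.mul_div_cancel_left J (by norm_num : 0 < 3)]
  -- `(1 − δ)^J ≤ e^{−δJ} ≤ ε`
  have hJge : Real.log (1 / ε) / δ ≤ (J : ℝ) := Nat.le_ceil _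
  have hδJ : Real.log (1 / ε) ≤ δ * J := by
    have := mul_le_mul_of_nonneg_left hJge hδ0.le
    rwa [mul_div_cancel₀ _ hδ0.ne'] at this
  calc (1 - δ) ^ J ≤ Real.exp (-δ) ^ J :=
        pow_le_pow_left₀ (by linarith) (by have := Real.one_sub_le_exp_neg δ; linarith) J
    _ = Real.exp (-(δ * J)) := by rw [← Real.exp_nat_mul]; ring_nf
    _ ≤ Real.exp (-Real.log (1 / ε)) := Real.exp_le_exp.mpr (by linarith)
    _ = ε := by rw [one_div, Real.log_inv, neg_neg, Real.exp_log hε]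

/-- **`t_mix(ε) ≤ 3·⌈log(1/ε)/(t((1−t)w_0)²p)⌉`, NO REGIME, NO VOLUME** (EXACT hot redraws; `0 < t < 1`, `w_0 > 0`, `0 < p`, `0 < ε`). [ours] -/
theorem twoLevel_mixingTime_le [Nonempty S] (hm : 1 ≤ m) (hμ : ∀ k x, 0 < μ k x) (hμ1 : ∀ k, ∑ u, μ k u = 1)
    (hM : ∀ k, IsRowStochastic (M k)) (hMrev : ∀ k, DetailedBalance (μ k) (M k)) (hM0 : ∀ u v, M 0 u v = μ 0 v)
    (hw0 : ∀ k, 0 ≤ w k) (hw1 : ∑ k, w k = 1) (hwhot : 0 < w 0) (ht0 : 0 < t) (ht1 : t < 1) (hp : 0 < p)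
    (hdom : ∀ r u, p * μ (κ r).succ (φ r u) ≤ μ 0 u) {ε : ℝ} (hε : 0 < ε) :
    mixingTime (fun a b : Fin (1 + 1) → S =>
        t * ptGraphSwap μ (fun r : Fin m => (((0 : Fin (1 + 1)), (κ r).succ) : Fin (1 + 1) × Fin (1 + 1))) φ a b
          + (1 - t) * prodKernel w M a b) (tensorFun μ) ε
      ≤ 3 * ⌈Real.log (1 / ε) / (t * ((1 - t) * w 0) ^ 2 * p)⌉₊ := by
  have h := twoLevel_mixingTime_le_of_minorized κ φ hm hμ hμ1 hM hMrev one_pos (fun u v => by rw [hM0, one_mul]) hw0 hw1 hwhot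
    ht0 ht1 hp hdom hε
  rwa [mul_one] at h

end TwoLevel

end Summit.Ventures.LatticeQCDFlow.Scaling

end
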